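import Literature.Computability.AlgebraicComplexity.BI17FormPolystabilityCriterion
import Literature.Computability.AlgebraicComplexity.BI17QuadraticPolystableProofs
import Literature.Computability.AlgebraicComplexity.FormTorusInstability
import HarnessLib

/-!
# Which monomials are polystable: `c X^α` has a Zariski-closed `SL`-orbit iff `α` is constant

A worked consequence of the two elementary tools around BI 2017 Prop. 2.8 (P. Bürgisser,
C. Ikenmeyer, *Fundamental invariants of orbit closures*, J. Algebra **477** (2017) 390–434,
§2.2 [BurgisserIkenmeyer2017]): the corrected sufficiency criterion
(`isPolystable_prod_X_pow`, `BI17FormPolystabilityCriterion.lean`) and the necessity of the cone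
condition (`not_isPolystable_of_posWeight`, `FormTorusInstability.lean`). For the diagonal torus
this is the monomial case of H. Derksen, V. Makam, *Polystability in positive characteristic and
degree lower bounds for invariant rings*, J. Comb. Algebra **6** (2022) 353–405, Cor. 3.2 (held text
`paper:doi-10-4171-jca-66` p0012:L12: "`f` is polystable if and only if `(d/n,…,d/n)` is in the
relative interior of `NP(f)`" — for a monomial `NP(f) = {α}`): here for the whole group `SL_m(ℂ)`.

* `zariskiClosure_singleton`, `isPolystable_C` — points are Zariski closed; constants are polystable.
* `IsPolystable.smul` — polystability of a form of positive degree is invariant under nonzero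
  scalars (over `ℂ`: `c = λ^D`, `λ • 1 ∈ GL`; via the tree's `IsPolystable.linSubst_of_det_ne_zero`).
* `not_isPolystable_monomial_of_ne` — if `α_i ≠ α_j` for some `i, j` then `c X^α` (`c ≠ 0`) is
  not polystable: the traceless weight `μ = α − (|α|/m)𝟙` has `⟨μ, α⟩ = ∑ μ_i² > 0`.
* `isPolystable_monomial_iff'` / `isPolystable_monomial_iff` — `c X^α` (`c ≠ 0`; any finite set of
  variables / `Fin m`) is polystable iff all exponents are equal.
* `isPolystable_sum_prod_X_blocks` — sums of variable-disjoint block monomials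
  `∑_b X_{(b,0)}⋯X_{(b,D-1)}` (`D ≥ 2`) are polystable (the consumable corrected criterion at work).

THEOREMS ONLY; cell `val-lit`, tooling around erratum A31. Honest framing: textbook GIT
bookkeeping; VP ≠ VNP is NOT proved and nothing here bears on it.

## References

* [BurgisserIkenmeyer2017] P. Bürgisser, C. Ikenmeyer, J. Algebra 477 (2017), §2.2, Prop. 2.8,
  Cor. 2.9.
* H. Derksen, V. Makam, J. Comb. Algebra 6 (2022) 353–405, Lemma 3.1, Cor. 3.2.
-/

noncomputable section

open MvPolynomial

namespace Literature.Computability.AlgebraicComplexity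

section Points

variable {k : Type*} [Field k] {ι : Type*}

/-- **Points are Zariski closed**: `zariskiClosure {v} = {v}` (the polynomials `X_d − v_d` vanish
at `v`). [cite: BurgisserIkenmeyer2017, Def. 2.7 (orbit closures in coefficient space)] -/
theorem zariskiClosure_singleton (v : ι → k) : zariskiClosure ({v} : Set (ι → k)) = {v} := by
  refine Set.Subset.antisymm ?_ (subset_zariskiClosure _)
  intro y hy
  rw [Set.mem_singleton_iff]
  funext d
  have h := (mem_zariskiClosure_iff.mp hy) (X d - C (v d)) fun z hz => by
    rw [Set.mem_singleton_iff.mp hz]; simp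
  simpa [sub_eq_zero] using h

end Points

section Scalars

variable {σ : Type*} [Fintype σ] [DecidableEq σ]

/-- **Constants are polystable**: the `SL`-orbit of `C c` is the single point `C c`.
[cite: BurgisserIkenmeyer2017, Def. 2.7] -/
theorem isPolystable_C (c : ℂ) : IsPolystable (C c : MvPolynomial σ ℂ) := by
  have horb : coeffVec '' slOrbit σ ℂ (C c : MvPolynomial σ ℂ) = {coeffVec (C c)} := by
    ext v
    simp only [Set.mem_image, mem_slOrbit_iff, Set.mem_singleton_iff]
    constructor
    · rintro ⟨h, ⟨g, rfl⟩, rfl⟩; rw [linSubst_C]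
    · rintro rfl; exact ⟨C c, ⟨1, by rw [linSubst_C]⟩, rfl⟩
  unfold IsPolystable
  rw [horb, zariskiClosure_singleton]

/-- **Polystability is invariant under nonzero scalars** (forms of positive degree over `ℂ`):
`c • f = (λ • 1) · f` with `λ^D = c`, and `λ • 1 ∈ GL`. [cite: BurgisserIkenmeyer2017, Def. 2.7] -/
theorem IsPolystable.smul {f : MvPolynomial σ ℂ} (hps : IsPolystable f) {D : ℕ}
    (hf : f.IsHomogeneous D) (hD : 0 < D) {c : ℂ} (hc : c ≠ 0) : IsPolystable (c • f) := by
  obtain ⟨lam, hlam⟩ := IsAlgClosed.exists_pow_nat_eq c hD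
  have hlam0 : lam ≠ 0 := by rintro rfl; rw [zero_pow hD.ne'] at hlam; exact hc hlam.symm
  have h1 : linSubst σ ℂ (lam • (1 : Matrix σ σ ℂ)) f = c • f := by
    rw [linSubst_smul_of_isHomogeneous hf, linSubst_one, AlgHom.id_apply, hlam]
  rw [← h1]
  refine hps.linSubst_of_det_ne_zero ?_
  rw [Matrix.det_smul, Matrix.det_one, mul_one]
  exact pow_ne_zero _ hlam0

end Scalars

section Monomials

variable {σ : Type*} [Fintype σ] [DecidableEq σ]

/-- **A monomial with two different exponents is not polystable**: for `c ≠ 0` and `α_i ≠ α_j`,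
the `SL`-orbit of `c X^α` is not Zariski closed — the traceless weight `μ = α − (|α|/m)·𝟙` has
`⟨μ, α⟩ = ∑_i μ_i² > 0`, so `diag(e^{-sμ}) · cX^α → 0` (`not_isPolystable_of_posWeight`). The
monomial case of the torus criterion of Derksen–Makam, Cor. 3.2.
[cite: BurgisserIkenmeyer2017, §2.2 (proof of Prop. 2.8)] -/
theorem not_isPolystable_monomial_of_ne (α : σ →₀ ℕ) {c : ℂ} (hc : c ≠ 0) {i j : σ}
    (hij : α i ≠ α j) : ¬ IsPolystable (monomial α c) := by
  classical
  set mean : ℝ := (∑ l, (α l : ℝ)) / Fintype.card σ with hmean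
  set μ : σ → ℝ := fun l => (α l : ℝ) - mean with hμ
  have hcard : (0 : ℝ) < Fintype.card σ := by
    have : 0 < Fintype.card σ := Fintype.card_pos_iff.mpr ⟨i⟩
    exact_mod_cast this
  have hμsum : ∑ l, μ l = 0 := by
    simp only [hμ, Finset.sum_sub_distrib, Finset.sum_const, Finset.card_univ, nsmul_eq_mul, hmean]
    field_simp
    ring
  refine not_isPolystable_of_posWeight _ (monomial_eq_zero.not.mpr hc) μ hμsum ?_
  intro β hβ
  rw [support_monomial, if_neg hc, Finset.mem_singleton] at hβ
  subst hβ
  -- `⟨μ, α⟩ = ∑ μ_l² > 0`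
  have hkey : ∑ l, μ l * (β l : ℝ) = ∑ l, μ l ^ 2 := by
    have h1 : ∀ l, μ l * (β l : ℝ) = μ l ^ 2 + mean * μ l := by
      intro l; simp only [hμ]; ring
    simp_rw [h1]
    rw [Finset.sum_add_distrib, ← Finset.mul_sum, hμsum, mul_zero, add_zero]
  rw [hkey]
  have hne : μ i ≠ 0 ∨ μ j ≠ 0 := by
    by_contra h
    push Not at h
    have : (β i : ℝ) = β j := by
      have hi := h.1; have hj := h.2
      simp only [hμ, sub_eq_zero] at hi hj
      rw [hi, hj]
    exact hij (by exact_mod_cast this)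
  rcases hne with h | h
  · exact lt_of_lt_of_le (by positivity) (Finset.single_le_sum (f := fun l => μ l ^ 2)
      (fun l _ => sq_nonneg (μ l)) (Finset.mem_univ i))
  · exact lt_of_lt_of_le (by positivity) (Finset.single_le_sum (f := fun l => μ l ^ 2)
      (fun l _ => sq_nonneg (μ l)) (Finset.mem_univ j))

/-- **Classification of polystable monomials (any finite set of variables).** For `c ≠ 0`, the
monomial `c X^α` has a Zariski-closed `SL(σ)`-orbit iff all exponents `α_i` are equal (`α = a·𝟙`:
then `c X^α = c (∏_i X_i)^a`, polystable by the corrected Prop. 2.8 —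
`isPolystable_univ_prod_X_pow` — or a constant; otherwise unstable by the weight `α − (|α|/|σ|)𝟙`).
The `SL` version of the monomial case of Derksen–Makam 2022, Cor. 3.2.
[cite: BurgisserIkenmeyer2017, Cor. 2.9 (the `X₁⋯X_m` clause) and §2.2] -/
theorem isPolystable_monomial_iff' (α : σ →₀ ℕ) {c : ℂ} (hc : c ≠ 0) :
    IsPolystable (monomial α c) ↔ ∀ i j : σ, α i = α j := by
  classical
  constructor
  · intro h i j
    by_contra hij
    exact not_isPolystable_monomial_of_ne α hc hij h
  · intro h
    rcases isEmpty_or_nonempty σ with hσ | ⟨⟨i₀⟩⟩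
    · have hα : α = 0 := by ext i; exact (IsEmpty.false i).elim
      rw [hα]
      exact isPolystable_C c
    · set a : ℕ := α i₀ with ha
      have hα : α = a • ∑ i : σ, Finsupp.single i 1 := by
        ext i
        rw [h i i₀, ← ha]
        simp only [Finsupp.coe_smul, Pi.smul_apply, smul_eq_mul, Finsupp.coe_finsetSum,
          Finset.sum_apply, Finsupp.single_apply, Finset.sum_ite_eq', Finset.mem_univ, if_true,
          mul_one]
      rcases Nat.eq_zero_or_pos a with ha0 | ha0
      · rw [hα, ha0, zero_smul]
        exact isPolystable_C c
      · have hf : (monomial α c : MvPolynomial σ ℂ) = c • (∏ i : σ, X i) ^ a := by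
          rw [show (∏ i : σ, X i : MvPolynomial σ ℂ) =
              monomial (∑ i : σ, Finsupp.single i 1) 1 from by rw [monomial_sum_one]; rfl,
            monomial_pow, one_pow, ← hα, smul_monomial, smul_eq_mul, mul_one]
        rw [hf]
        have hhom : ((∏ i : σ, X i) ^ a : MvPolynomial σ ℂ).IsHomogeneous (Fintype.card σ * a) := by
          have h1 : (∏ i : σ, X i : MvPolynomial σ ℂ).IsHomogeneous (Fintype.card σ) := by
            have := IsHomogeneous.prod (Finset.univ : Finset σ) (fun i => (X i : MvPolynomial σ ℂ))
              (fun _ => 1) (fun i _ => isHomogeneous_X ℂ i)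
            simpa using this
          simpa using h1.pow a
        exact (isPolystable_univ_prod_X_pow a ha0).smul hhom (Nat.mul_pos (Fintype.card_pos_iff.mpr ⟨i₀⟩) ha0) hc

/-- **Classification of polystable monomials** (variables `X_0, …, X_{m-1}`): for `c ≠ 0`, the
monomial `c X^α` has a Zariski-closed `SL_m(ℂ)`-orbit iff all exponents `α_i` are equal; the `Fin m`
instance of `isPolystable_monomial_iff'`. [cite: BurgisserIkenmeyer2017, Cor. 2.9 (the `X₁⋯X_m` clause) and §2.2] -/
theorem isPolystable_monomial_iff {m : ℕ} (α : Fin m →₀ ℕ) {c : ℂ} (hc : c ≠ 0) :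
    IsPolystable (monomial α c) ↔ ∀ i j : Fin m, α i = α j :=
  isPolystable_monomial_iff' α hc

/-- The diagonal substitution used for separation: `2` at `p₁`, `1/2` at `p₂`, `1` elsewhere; its
product over a set containing both or neither of `p₁ ≠ p₂` is `1`. [folklore] -/
private theorem prod_update_two_half {σ : Type*} [DecidableEq σ] {p₁ p₂ : σ} (h : p₁ ≠ p₂)
    (s : Finset σ) (hs : p₁ ∈ s ↔ p₂ ∈ s) :
    ∏ i ∈ s, Function.update (Function.update (fun _ : σ => (1 : ℂ)) p₁ 2) p₂ (1 / 2) i = 1 := by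
  by_cases h1 : p₁ ∈ s
  · have h2 : p₂ ∈ s := hs.mp h1
    rw [← Finset.mul_prod_erase _ _ h2, Function.update_self,
      ← Finset.mul_prod_erase _ _ (Finset.mem_erase.mpr ⟨h, h1⟩), Function.update_of_ne h,
      Function.update_self, Finset.prod_eq_one fun i hi => ?_]
    · norm_num
    · rw [Function.update_of_ne (Finset.ne_of_mem_erase (Finset.mem_of_mem_erase hi)),
        Function.update_of_ne (Finset.ne_of_mem_erase hi)]
  · have h2 : p₂ ∉ s := fun h2 => h1 (hs.mpr h2)
    exact Finset.prod_eq_one fun i hi => by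
      have hi2 : i ≠ p₂ := fun e => h2 (e ▸ hi)
      have hi1 : i ≠ p₁ := fun e => h1 (e ▸ hi)
      rw [Function.update_of_ne hi2, Function.update_of_ne hi1]

/-- **Application: sums of variable-disjoint block monomials are polystable.** For a finite index
set `B` of blocks and block length `D ≥ 2`, the form `∑_{b ∈ B} X_{(b,0)} X_{(b,1)} ⋯ X_{(b,D-1)}`
in the `|B|·D` variables `X_{(b,j)}` has a Zariski-closed `SL`-orbit — e.g. the full-rank quadric
`∑_b X_{(b,0)} X_{(b,1)}` (`D = 2`) and `x₁x₂x₃ + x₄x₅x₆ + ⋯` (`D = 3`). By the consumable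
corrected criterion `isPolystable_of_separating_diagonalStabilizers`: the support consists of the
block indicators `𝟙_b`, which sum to `𝟙` (`c = 1`), and `diag(2 at p, 1/2 at p', 1 elsewhere)` with
`p, p'` in one block fixes the form and separates `p` from every other variable. (For `D = 1` the
form is linear and not polystable.) [cite: BurgisserIkenmeyer2017, Prop. 2.8 (corrected) / Cor. 2.9 (method)] -/
theorem isPolystable_sum_prod_X_blocks (B : Type*) [Fintype B] [DecidableEq B] {D : ℕ} (hD : 2 ≤ D) :
    IsPolystable (∑ b : B, ∏ j : Fin D, X (b, j) : MvPolynomial (B × Fin D) ℂ) := by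
  classical
  -- the block indicator exponents
  set ind : B → (B × Fin D →₀ ℕ) := fun b => ∑ j : Fin D, Finsupp.single (b, j) 1 with hind
  have hind_apply : ∀ b q, ind b q = if q.1 = b then 1 else 0 := by
    intro b q
    simp only [hind, Finsupp.coe_finsetSum, Finset.sum_apply, Finsupp.single_apply]
    by_cases hq : q.1 = b
    · rw [if_pos hq, Finset.sum_eq_single q.2]
      · rw [if_pos (Prod.ext hq.symm rfl : (b, q.2) = q)]
      · intro j _ hj
        exact if_neg fun e => hj (congrArg Prod.snd e)
      · intro h; exact absurd (Finset.mem_univ _) h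
    · rw [if_neg hq]
      exact Finset.sum_eq_zero fun j _ => if_neg fun e => hq (congrArg Prod.fst e).symm
  have hind_inj : Function.Injective ind := by
    intro b b' h
    have h1 := congrArg (fun α => α (b', (⟨0, by omega⟩ : Fin D))) h
    simp only [hind_apply, if_true] at h1
    by_contra hne
    rw [if_neg (Ne.symm hne)] at h1
    exact zero_ne_one h1
  have hf : (∑ b : B, ∏ j : Fin D, X (b, j) : MvPolynomial (B × Fin D) ℂ) =
      ∑ b : B, monomial (ind b) 1 := by
    refine Finset.sum_congr rfl fun b _ => ?_
    rw [hind, monomial_sum_one]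
    rfl
  -- homogeneity
  have hhom : (∑ b : B, ∏ j : Fin D, X (b, j) : MvPolynomial (B × Fin D) ℂ).IsHomogeneous D := by
    rw [hf]
    refine IsHomogeneous.sum _ _ _ fun b _ => isHomogeneous_monomial _ ?_
    rw [Finsupp.degree_eq_sum]
    simp only [hind_apply]
    rw [Finset.sum_boole]
    have : (Finset.univ.filter fun q : B × Fin D => q.1 = b) = Finset.univ.image fun j : Fin D => (b, j) := by
      ext q
      simp only [Finset.mem_filter, Finset.mem_univ, true_and, Finset.mem_image]
      constructor
      · intro h; exact ⟨q.2, Prod.ext h.symm rfl⟩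
      · rintro ⟨j, rfl⟩; rfl
    rw [this, Finset.card_image_of_injective _ (fun j j' h => (Prod.mk.inj h).2)]
    simp
  -- the support
  have hsupp : (∑ b : B, ∏ j : Fin D, X (b, j) : MvPolynomial (B × Fin D) ℂ).support =
      Finset.univ.image ind := by
    rw [hf]
    ext α
    rw [mem_support_iff, coeff_sum, Finset.mem_image]
    simp only [coeff_monomial]
    constructor
    · intro h
      obtain ⟨b, _, hb⟩ := Finset.exists_ne_zero_of_sum_ne_zero h
      exact ⟨b, Finset.mem_univ _, (by by_contra hne; exact hb (if_neg hne))⟩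
    · rintro ⟨b, _, rfl⟩
      rw [Finset.sum_eq_single b]
      · rw [if_pos rfl]; exact one_ne_zero
      · intro b' _ hb'; rw [if_neg (fun e => hb' (hind_inj e))]
      · intro h; exact absurd (Finset.mem_univ _) h
  refine isPolystable_of_separating_diagonalStabilizers _ hhom ?_ (fun _ => 1) (fun _ _ => one_pos) ?_
  · -- separation
    intro p q hpq
    -- a second variable `p'` in the block of `p`
    have hex : ∃ p' : B × Fin D, p'.1 = p.1 ∧ p' ≠ p := by
      obtain ⟨j, hj⟩ : ∃ j : Fin D, j ≠ p.2 := by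
        by_cases h0 : p.2 = ⟨0, by omega⟩
        · exact ⟨⟨1, by omega⟩, by rw [h0]; simp [Fin.ext_iff]⟩
        · exact ⟨⟨0, by omega⟩, Ne.symm h0⟩
      exact ⟨(p.1, j), rfl, fun e => hj (congrArg Prod.snd e)⟩
    obtain ⟨p', hp'1, hp'p⟩ := hex
    refine ⟨Function.update (Function.update (fun _ => (1 : ℂ)) p 2) p' (1 / 2), ?_, ?_⟩
    · rw [hf, map_sum]
      refine Finset.sum_congr rfl fun b _ => ?_
      rw [linSubst_diagonal_monomial, Finsupp.prod_fintype _ _ (fun i => pow_zero _)]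
      simp only [hind_apply, pow_ite, pow_one, pow_zero]
      rw [← Finset.prod_filter, prod_update_two_half (Ne.symm hp'p)]
      · rw [one_smul]
      · simp only [Finset.mem_filter, Finset.mem_univ, true_and, hp'1]
    · have hdp : Function.update (Function.update (fun _ : B × Fin D => (1 : ℂ)) p 2) p' (1 / 2) p
          = 2 := by
        rw [Function.update_of_ne (Ne.symm hp'p), Function.update_self]
      rw [hdp]
      by_cases hq' : q = p'
      · rw [hq', Function.update_self]; norm_num
      · rw [Function.update_of_ne hq', Function.update_of_ne (Ne.symm hpq)]; norm_num
  · -- the cone condition: `∑_b 𝟙_b = 𝟙`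
    intro i
    rw [hsupp, Finset.sum_image fun b _ b' _ h => hind_inj h]
    simp only [one_mul, hind_apply]
    push_cast
    rw [Finset.sum_ite_eq, if_pos (Finset.mem_univ _)]

end Monomials

end Literature.Computability.AlgebraicComplexity
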